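import Summits.Ventures.PercRepro.S1ChainSkewCap

/-!
# PercRepro — THE SHARP ONE-POINT FOUR-CIRCUIT CAP: THREE (p2, gen 24; SUBCLAIM-S1 §6.9 (vii) step 4, sharp form)

S1ChainSkewCap bounds the four-circuits through an outside point `z` of a skew union by `4`. The sharp value is
`3`: when a one-point trace occurs the principal trace `F` has only two points (`|F| + 1 ≤ |B| = 3`, the pair-
carrying triangle paying one), so the traces are among `C(2, 3) + C(2, 1) = 2` sets; when every trace has three
points and `|F| = 4`, the shape `(ℓ, q) = (1, 1)` puts the one point `a` of `F` off its triangle into EVERY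
circuit, and the traces are among the `C(3, 2) = 3` three-subsets of `F` through `a`.

* `ncard_principal_le_two_of_one_point` — `|F| ≤ 2` when some trace has one point;
* `exists_mem_of_ncard_principal_eq_four` — at `|F| = 4` the off-triangle point lies in every circuit;
* **`ncard_fourCircuits_through_le_three`** — the sharp cap.
Axioms: standard.
-/

open scoped Matroid

namespace PercRepro

namespace S1

open Set

variable {α : Type}

open scoped Classical in
/-- **`|F| ≤ 2` WHEN A TRACE HAS ONE POINT**: the triangle carrying the two-point trace pays one. -/
theorem ncard_principal_le_two_of_one_point (M : Matroid α) [M.Finite] (𝒯 : Finset (Set α))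
    (h𝒯 : ∀ C ∈ 𝒯, M.IsCircuit C ∧ C.ncard = 3) (hskew : M.eRk (⋃ C ∈ 𝒯, C) = 2 * 𝒯.card)
    {z : α} (hzU : z ∉ ⋃ C ∈ 𝒯, C) {F : Set α} (hFU : F ⊆ ⋃ C ∈ 𝒯, C)
    (hFcl : ∀ T ∈ 𝒯, (F ∩ T).ncard ≤ 1 ∨ T ⊆ F) (hzF : z ∈ M.closure F)
    (hFmin : ∀ A ⊆ ⋃ C ∈ 𝒯, C, (∀ T ∈ 𝒯, (A ∩ T).ncard ≤ 1 ∨ T ⊆ A) → z ∈ M.closure A → F ⊆ A)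
    {B : Set α} (hB : B ⊆ ⋃ C ∈ 𝒯, C) (hC : M.IsCircuit (insert z B)) (hB3 : B.ncard = 3)
    (h1 : (B ∩ F).ncard = 1) : F.ncard ≤ 2 := by
  have hUfin : (⋃ C ∈ 𝒯, C).Finite := M.ground_finite.subset (biUnion_subset_ground M 𝒯 h𝒯)
  have hBfin : B.Finite := hUfin.subset hB
  -- the point of `B` off `F` and its triangle
  have hne : (B \ F).Nonempty := by
    rw [Set.nonempty_iff_ne_empty]
    intro h
    have := Set.ncard_inter_add_ncard_sdiff_eq_ncard B F hBfin
    rw [h, Set.ncard_empty, h1, hB3] at this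
    omega
  obtain ⟨x, hxB, hxF⟩ := hne
  obtain ⟨T₁, hT₁, hxT₁⟩ := Set.mem_iUnion₂.1 (hB hxB)
  -- the trace on `T₁` has two points and `F ∩ T₁` one
  obtain ⟨hBT₁, hFT₁⟩ : (B ∩ T₁).ncard = 2 ∧ (F ∩ T₁).ncard = 1 := by
    rcases trace_cases M 𝒯 h𝒯 hskew hzU hFU hFcl hzF hFmin hB hC hT₁ with ⟨hBT, -⟩ | ⟨hTF, -⟩ | ⟨a, hFa, hBa⟩
    · exfalso
      have : x ∈ B ∩ T₁ := ⟨hxB, hxT₁⟩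
      rw [hBT] at this
      exact this
    · exact absurd (hTF hxT₁) hxF
    · rcases hBa with hBa | ⟨h2, -⟩
      · exfalso
        have : x ∈ B ∩ T₁ := ⟨hxB, hxT₁⟩
        rw [hBa] at this
        exact hxF (Set.mem_singleton_iff.1 this ▸ ((Set.ext_iff.1 hFa a).2 rfl).1)
      · exact ⟨h2, by rw [hFa, Set.ncard_singleton]⟩
  -- no triangle lies inside `F`
  have hnoL : ∀ T ∈ 𝒯, ¬ T ⊆ F := by
    rcases ncard_inter_principal_cases M 𝒯 h𝒯 hskew hzU hFU hFcl hzF hFmin hB hC hB3 with h3 | ⟨-, h⟩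
    · omega
    · exact h
  -- termwise: `|F ∩ T| + [T = T₁] ≤ |B ∩ T|`
  have hterm : ∀ T ∈ 𝒯, (F ∩ T).ncard + (if T = T₁ then 1 else 0) ≤ (B ∩ T).ncard := by
    intro T hT
    by_cases hTT : T = T₁
    · rw [if_pos hTT, hTT, hFT₁, hBT₁]
    · rw [if_neg hTT, add_zero]
      exact (ncard_inter_principal_le M 𝒯 h𝒯 hskew hzU hFU hFcl hzF hFmin hB hC hT).2 (hnoL T hT)
  have hsum := Finset.sum_le_sum hterm
  rw [Finset.sum_add_distrib, Finset.sum_ite_eq' 𝒯 T₁, if_pos hT₁,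
    ← ncard_eq_sum_inter_of_skew_union M 𝒯 h𝒯 hskew hFU, ← ncard_eq_sum_inter_of_skew_union M 𝒯 h𝒯 hskew hB,
    hB3] at hsum
  omega

open scoped Classical in
/-- **AT `|F| = 4` EVERY CIRCUIT CONTAINS THE OFF-TRIANGLE POINT**: `F = T ∪ {a}` with `T` a triangle, and the
trace of a circuit through `z` on the triangle of `a` is `{a}` (two points there and two on `T` would make four). -/
theorem exists_mem_of_ncard_principal_eq_four (M : Matroid α) [M.Finite] (𝒯 : Finset (Set α))
    (h𝒯 : ∀ C ∈ 𝒯, M.IsCircuit C ∧ C.ncard = 3) (hskew : M.eRk (⋃ C ∈ 𝒯, C) = 2 * 𝒯.card)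
    {z : α} (hzU : z ∉ ⋃ C ∈ 𝒯, C) {F : Set α} (hFU : F ⊆ ⋃ C ∈ 𝒯, C)
    (hFcl : ∀ T ∈ 𝒯, (F ∩ T).ncard ≤ 1 ∨ T ⊆ F) (hzF : z ∈ M.closure F)
    (hFmin : ∀ A ⊆ ⋃ C ∈ 𝒯, C, (∀ T ∈ 𝒯, (A ∩ T).ncard ≤ 1 ∨ T ⊆ A) → z ∈ M.closure A → F ⊆ A)
    {B₀ : Set α} (hB₀ : B₀ ⊆ ⋃ C ∈ 𝒯, C) (hC₀ : M.IsCircuit (insert z B₀)) (hB₀3 : B₀.ncard = 3)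
    (hF4 : F.ncard = 4) :
    ∃ a ∈ F, ∀ B ⊆ ⋃ C ∈ 𝒯, C, M.IsCircuit (insert z B) → B.ncard = 3 → a ∈ B := by
  have hUfin : (⋃ C ∈ 𝒯, C).Finite := M.ground_finite.subset (biUnion_subset_ground M 𝒯 h𝒯)
  have hFfin : F.Finite := hUfin.subset hFU
  -- a triangle inside `F` exists (else `|F| ≤ 3`)
  have hL : ∃ T ∈ 𝒯, T ⊆ F := by
    by_contra hno
    push Not at hno
    have := (ncard_principal_le M 𝒯 h𝒯 hskew hzU hFU hFcl hzF hFmin hB₀ hC₀ hB₀3).2 hno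
    omega
  obtain ⟨T, hT, hTF⟩ := hL
  have hTfin : T.Finite := M.ground_finite.subset (h𝒯 T hT).1.subset_ground
  -- the point of `F` off `T`
  have hFT : (F \ T).ncard = 1 := by
    have := Set.ncard_inter_add_ncard_sdiff_eq_ncard F T hFfin
    rw [Set.inter_eq_right.2 hTF, (h𝒯 T hT).2, hF4] at this
    omega
  obtain ⟨a, ha⟩ := Set.ncard_eq_one.1 hFT
  have haF : a ∈ F := ((Set.ext_iff.1 ha a).2 rfl).1
  have haT : a ∉ T := ((Set.ext_iff.1 ha a).2 rfl).2
  refine ⟨a, haF, fun B hB hC hB3 => ?_⟩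
  have hBfin : B.Finite := hUfin.subset hB
  obtain ⟨Ta, hTa, haTa⟩ := Set.mem_iUnion₂.1 (hFU haF)
  have hne : Ta ≠ T := fun h => haT (h ▸ haTa)
  -- `F ∩ Ta = {a}`
  have hFTa : F ∩ Ta = {a} := by
    ext w; simp only [Set.mem_inter_iff, Set.mem_singleton_iff]
    constructor
    · rintro ⟨hwF, hwTa⟩
      by_contra hwa
      have hwT : w ∉ T := fun h => Set.disjoint_left.1 (disjoint_of_skew_union M 𝒯 h𝒯 hskew hTa hT hne) hwTa h
      have : w ∈ F \ T := ⟨hwF, hwT⟩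
      rw [ha] at this
      exact hwa this
    · rintro rfl; exact ⟨haF, haTa⟩
  -- the trace of `B` on `Ta` is `{a}`: two points there and two on `T` would be four
  rcases trace_cases M 𝒯 h𝒯 hskew hzU hFU hFcl hzF hFmin hB hC hTa with ⟨-, hFT'⟩ | ⟨hTaF, -⟩ | ⟨a', hFa', hBa'⟩
  · exfalso
    have : a ∈ F ∩ Ta := ⟨haF, haTa⟩
    rw [hFT'] at this
    exact this
  · exfalso
    have : Ta ⊆ F ∩ Ta := fun w hw => ⟨hTaF hw, hw⟩
    rw [hFTa] at this
    have h3 := (h𝒯 Ta hTa).2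
    have := Set.ncard_le_ncard this (Set.finite_singleton a)
    rw [Set.ncard_singleton] at this
    omega
  · have haa' : a' = a := by
      have : a' ∈ F ∩ Ta := by rw [hFa']; rfl
      rw [hFTa] at this
      exact this
    rw [haa'] at hBa'
    rcases hBa' with hBa | ⟨h2, -⟩
    · exact ((Set.ext_iff.1 hBa a).2 rfl).1
    · exfalso
      have h2T := ncard_inter_eq_two_of_subset_principal M 𝒯 h𝒯 hskew hzU hFU hzF hFmin hB hC hT hTF
      have hd : Disjoint (B ∩ T) (B ∩ Ta) := by
        rw [Set.disjoint_left]
        rintro w ⟨-, hw1⟩ ⟨-, hw2⟩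
        exact Set.disjoint_left.1 (disjoint_of_skew_union M 𝒯 h𝒯 hskew hTa hT hne) hw2 hw1
      have := Set.ncard_le_ncard (Set.union_subset Set.inter_subset_left Set.inter_subset_left :
        (B ∩ T) ∪ (B ∩ Ta) ⊆ B) hBfin
      rw [Set.ncard_union_eq hd (hBfin.subset Set.inter_subset_left) (hBfin.subset Set.inter_subset_left), h2T,
        h2, hB3] at this
      omega

/-- **THE SHARP ONE-POINT FOUR-CIRCUIT CAP**: at most THREE four-circuits through an outside point `z` of a skew
union lie inside `U ∪ {z}`. -/
theorem ncard_fourCircuits_through_le_three (M : Matroid α) [M.Finite] (𝒯 : Finset (Set α))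
    (h𝒯 : ∀ C ∈ 𝒯, M.IsCircuit C ∧ C.ncard = 3) (hskew : M.eRk (⋃ C ∈ 𝒯, C) = 2 * 𝒯.card)
    {z : α} (hzE : z ∈ M.E) (hzU : z ∉ ⋃ C ∈ 𝒯, C) (hzcl : z ∈ M.closure (⋃ C ∈ 𝒯, C)) :
    {C : Set α | M.IsCircuit C ∧ C.ncard = 4 ∧ z ∈ C ∧ C ⊆ insert z (⋃ C' ∈ 𝒯, C')}.ncard ≤ 3 := by
  classical
  obtain ⟨F, hFU, hFcl, hzF, hFmin⟩ := exists_principal_closedTrace M 𝒯 h𝒯 hskew hzE hzcl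
  have hUfin : (⋃ C ∈ 𝒯, C).Finite := M.ground_finite.subset (biUnion_subset_ground M 𝒯 h𝒯)
  have hFfin : F.Finite := hUfin.subset hFU
  have hzF' : z ∉ F := fun h => hzU (hFU h)
  set 𝒞 := {C : Set α | M.IsCircuit C ∧ C.ncard = 4 ∧ z ∈ C ∧ C ⊆ insert z (⋃ C' ∈ 𝒯, C')} with h𝒞
  have hmem : ∀ C ∈ 𝒞, (C \ {z}) ⊆ ⋃ C' ∈ 𝒯, C' ∧ (C \ {z}).ncard = 3 ∧ M.IsCircuit (insert z (C \ {z})) ∧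
      C ∩ F = (C \ {z}) ∩ F := by
    intro C hC
    obtain ⟨hcirc, h4, hzC, hsub⟩ := hC
    refine ⟨?_, ?_, ?_, ?_⟩
    · rintro x ⟨hxC, hxz⟩
      rcases hsub hxC with h | h
      · exact absurd h hxz
      · exact h
    · rw [Set.ncard_sdiff_singleton_of_mem hzC, h4]
    · rwa [Set.insert_sdiff_singleton, Set.insert_eq_of_mem hzC]
    · ext x; simp only [Set.mem_inter_iff, Set.mem_sdiff, Set.mem_singleton_iff]
      constructor
      · rintro ⟨hxC, hxF⟩; exact ⟨⟨hxC, fun h => hzF' (h ▸ hxF)⟩, hxF⟩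
      · rintro ⟨⟨hxC, -⟩, hxF⟩; exact ⟨hxC, hxF⟩
  have hinj : Set.InjOn (fun C => C ∩ F) 𝒞 := by
    intro C hC C' hC' heq
    obtain ⟨hB, -, hcirc, hCF⟩ := hmem C hC
    obtain ⟨hB', -, hcirc', hCF'⟩ := hmem C' hC'
    simp only at heq
    rw [hCF, hCF'] at heq
    have := eq_of_inter_principal_eq M 𝒯 h𝒯 hskew hzU hFU hFcl hzF hFmin hB hcirc hB' hcirc' heq
    have hzC : z ∈ C := hC.2.2.1
    have hzC' : z ∈ C' := hC'.2.2.1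
    calc C = insert z (C \ {z}) := by rw [Set.insert_sdiff_singleton, Set.insert_eq_of_mem hzC]
      _ = insert z (C' \ {z}) := by rw [this]
      _ = C' := by rw [Set.insert_sdiff_singleton, Set.insert_eq_of_mem hzC']
  have himg : ∀ C ∈ 𝒞, (C ∩ F).ncard = 3 ∨ ((C ∩ F).ncard = 1 ∧ ∀ T ∈ 𝒯, ¬ T ⊆ F) := by
    intro C hC
    obtain ⟨hB, hB3, hcirc, hCF⟩ := hmem C hC
    rw [hCF]
    exact ncard_inter_principal_cases M 𝒯 h𝒯 hskew hzU hFU hFcl hzF hFmin hB hcirc hB3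
  have hsub3 : ∀ C ∈ 𝒞, C ∩ F ⊆ F := fun C _ => Set.inter_subset_right
  rcases Set.eq_empty_or_nonempty 𝒞 with hempty | ⟨C₀, hC₀⟩
  · rw [hempty, Set.ncard_empty]; omega
  obtain ⟨hB₀, hB₀3, hcirc₀, hCF₀⟩ := hmem C₀ hC₀
  by_cases hA : ∃ C ∈ 𝒞, (C ∩ F).ncard = 1
  · -- a one-point trace: `|F| ≤ 2`, the traces are one- or three-subsets of `F`
    obtain ⟨C₁, hC₁, h1⟩ := hA
    obtain ⟨hB₁, hB₁3, hcirc₁, hCF₁⟩ := hmem C₁ hC₁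
    rw [hCF₁] at h1
    have hF2 := ncard_principal_le_two_of_one_point M 𝒯 h𝒯 hskew hzU hFU hFcl hzF hFmin hB₁ hcirc₁ hB₁3 h1
    set 𝒳₃ := {X : Set α | X ⊆ F ∧ X.ncard = 3} with h𝒳₃
    set 𝒳₁ := {X : Set α | X ⊆ F ∧ X.ncard = 1} with h𝒳₁
    have h𝒳₃fin : 𝒳₃.Finite := hFfin.finite_subsets.subset (fun X hX => hX.1)
    have h𝒳₁fin : 𝒳₁.Finite := hFfin.finite_subsets.subset (fun X hX => hX.1)
    have hc3 : 𝒳₃.ncard = F.ncard.choose 3 := ncard_subsets_eq_choose F hFfin 3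
    have hc1 : 𝒳₁.ncard = F.ncard.choose 1 := ncard_subsets_eq_choose F hFfin 1
    have hle : 𝒞.ncard ≤ (𝒳₃ ∪ 𝒳₁).ncard := by
      refine Set.ncard_le_ncard_of_injOn (fun C => C ∩ F) (fun C hC => ?_) hinj (h𝒳₃fin.union h𝒳₁fin)
      rcases himg C hC with h3 | ⟨h1', -⟩
      · exact Or.inl ⟨hsub3 C hC, h3⟩
      · exact Or.inr ⟨hsub3 C hC, h1'⟩
    have hunion := Set.ncard_union_le 𝒳₃ 𝒳₁
    rw [hc3, hc1, Nat.choose_one_right] at hunion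
    have hch : F.ncard.choose 3 = 0 := Nat.choose_eq_zero_of_lt (by omega)
    omega
  · -- every trace has three points: the traces are three-subsets of `F`, `|F| ≤ 4`
    push Not at hA
    have hF4 : F.ncard ≤ 4 :=
      (ncard_principal_le M 𝒯 h𝒯 hskew hzU hFU hFcl hzF hFmin hB₀ hcirc₀ hB₀3).1
    have hall3 : ∀ C ∈ 𝒞, (C ∩ F).ncard = 3 := by
      intro C hC
      rcases himg C hC with h3 | ⟨h1', -⟩
      · exact h3
      · exact absurd h1' (hA C hC)
    by_cases hF4' : F.ncard = 4
    · -- `F = T ∪ {a}` and every trace contains `a`: the three-subsets of `F` through `a`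
      obtain ⟨a, haF, hmemA⟩ := exists_mem_of_ncard_principal_eq_four M 𝒯 h𝒯 hskew hzU hFU hFcl hzF hFmin
        hB₀ hcirc₀ hB₀3 hF4'
      set 𝒴 := {Y : Set α | Y ⊆ F \ {a} ∧ Y.ncard = 2} with h𝒴
      have h𝒴fin : 𝒴.Finite := (hFfin.subset Set.sdiff_subset).finite_subsets.subset (fun Y hY => hY.1)
      have hc2 : 𝒴.ncard = (F \ {a}).ncard.choose 2 :=
        ncard_subsets_eq_choose (F \ {a}) (hFfin.subset Set.sdiff_subset) 2
      rw [Set.ncard_sdiff_singleton_of_mem haF, hF4'] at hc2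
      have hc2' : 𝒴.ncard = 3 := by rw [hc2]; decide
      have hle : 𝒞.ncard ≤ 𝒴.ncard := by
        refine Set.ncard_le_ncard_of_injOn (fun C => (C ∩ F) \ {a}) (fun C hC => ?_) ?_ h𝒴fin
        · obtain ⟨hB, hB3, hcirc, hCF⟩ := hmem C hC
          have haC : a ∈ C ∩ F := by
            rw [hCF]
            exact ⟨hmemA _ hB hcirc hB3, haF⟩
          refine ⟨Set.sdiff_subset_sdiff_left Set.inter_subset_right, ?_⟩
          rw [Set.ncard_sdiff_singleton_of_mem haC, hall3 C hC]
        · intro C hC C' hC' heq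
          simp only at heq
          obtain ⟨hB, hB3, hcirc, hCF⟩ := hmem C hC
          obtain ⟨hB', hB'3, hcirc', hCF'⟩ := hmem C' hC'
          have haC : a ∈ C ∩ F := by rw [hCF]; exact ⟨hmemA _ hB hcirc hB3, haF⟩
          have haC' : a ∈ C' ∩ F := by rw [hCF']; exact ⟨hmemA _ hB' hcirc' hB'3, haF⟩
          have : C ∩ F = C' ∩ F := by
            calc C ∩ F = insert a ((C ∩ F) \ {a}) := by
                  rw [Set.insert_sdiff_singleton, Set.insert_eq_of_mem haC]
              _ = insert a ((C' ∩ F) \ {a}) := by rw [heq]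
              _ = C' ∩ F := by rw [Set.insert_sdiff_singleton, Set.insert_eq_of_mem haC']
          exact hinj hC hC' this
      omega
    · have hF3 : F.ncard ≤ 3 := by omega
      set 𝒳₃ := {X : Set α | X ⊆ F ∧ X.ncard = 3} with h𝒳₃
      have h𝒳₃fin : 𝒳₃.Finite := hFfin.finite_subsets.subset (fun X hX => hX.1)
      have hc3 : 𝒳₃.ncard = F.ncard.choose 3 := ncard_subsets_eq_choose F hFfin 3
      have hle : 𝒞.ncard ≤ 𝒳₃.ncard := by
        refine Set.ncard_le_ncard_of_injOn (fun C => C ∩ F) (fun C hC => ?_) hinj h𝒳₃fin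
        exact ⟨hsub3 C hC, hall3 C hC⟩
      have hch : F.ncard.choose 3 ≤ 1 := by
        interval_cases F.ncard <;> decide
      omega

end S1

end PercRepro
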